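import Summits.Ventures.Crystal3D.Theorems.StickyWulffConstantCoaxialWallLawOneFccLayerSums
import Summits.Ventures.Crystal3D.Theorems.StickyWulffConstantTextureLiminfTexShadowOneFccFrames
import Summits.Ventures.Crystal3D.Theorems.StickyWulffConstantTextureLiminfTexShadowBilayerFrameRigidity
import Summits.Ventures.Crystal3D.Theorems.StickyWulffConstantCoaxialWallLawEndRowDefs
import HarnessLib

/-!
# The ONE-FCC F_layer: FLUX BOUND for the fcc plate — B-sources from below, re-presented and re-phased (file (i) of the two-family ledger)

HONEST FRAMING. Venture `Summits/Ventures/Crystal3D` (cell `crystal3d-full`); helper `--supports` the crux `CoaxialWallLaw`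
(stmt-Ventures-19481, REGISTERED line `WallLedgerF`) in its role as owner of lane T's debt T-F2 / F_layer, OneFcc half (cf-p1 (civ)/(cxx);
memo HOME/wall-19481-p1/g16/TWO-FAMILY-LEDGER-g16.md §Ledger (I2)).  Lattice-line counting only; census-free, standard axioms; nothing about
the crux is claimed; F-C1 not moved.

* `image_fccRef_eq_of_image_fccSlots_eq` — equal slot dozens ⇒ equal linear lattices (`image_fccRef_subset_of_unitVec`);
* `stacking_const_eq_of_dozen` — a sign-constant plate `stacking L s σ` (`σ ≡ ε`, reading frame `Gf`) IS `stacking Fr s constHagg` for every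
  frame `Fr` carrying its dozen (`Fr '' D = Gf '' D`): the RE-PRESENTATION of the fcc plate by the root frame of family B;
* `oneFcc_srcB_layers_ge` — (I2) raw: ALL core balls of `stacking FrB s' constHagg` crossing height `−R₀−2` along the rising in-plane roots
  of `FrB` number at least `Σ_{m ∈ K} (Φ·G_m − #RT)` for ANY finite layer set `K` (`plate_tops_ge`);
* `ap_rephase` + **`oneFcc_srcB_ge`** — (I2) in the ledger's phase: for every `x₀, ψ` and window `Kw` there is `ψ'`, `|ψ' − ψ| ≤ d`, with
  `Σ_{k ∈ Kw} (Φ·G(x₀ + k d + ψ') − #RT) ≤ #sources` (the fcc plate's planes are an arithmetic progression of the same step `d = √(2/3)`).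
WHAT THIS IS NOT: the faulted plate's counts (file (h)), the charge, the assembly; F-C1 not moved.
-/

noncomputable section

namespace Summit.Ventures.Crystal3D.Theorems

open Summit.Ventures.Crystal3D Finset
open Literature.MathematicalPhysics.StatisticalMechanics (barlowPos barlowStacking barlowPos_mem constHagg fccStacking basalMirror)
open Summit.Ventures.Crystal3D.Cruxes.TextureLiminf.TexShadow (E3 fccRef stacking stacking_constHagg stacking_const_neg
  const_one_eq_constHagg)
open scoped InnerProductSpace

/-- **Equal slot dozens ⇒ equal linear lattices.** -/
theorem image_fccRef_eq_of_image_fccSlots_eq {A B : E3 ≃ₗᵢ[ℝ] E3}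
    (h : (A : E3 → E3) '' ↑fccSlots = (B : E3 → E3) '' ↑fccSlots) : A '' fccRef = B '' fccRef := by
  have key : ∀ {A B : E3 ≃ₗᵢ[ℝ] E3}, (A : E3 → E3) '' ↑fccSlots = (B : E3 → E3) '' ↑fccSlots → A '' fccRef ⊆ B '' fccRef := by
    intro A B h
    refine TentCertificate.image_fccRef_subset_of_unitVec fun w hw => ?_
    have hwS : w ∈ fccSlots := mem_fccSlots_of_unit hw.1 hw.2
    have hAw : A w ∈ (A : E3 → E3) '' ↑fccSlots := ⟨w, Finset.mem_coe.2 hwS, rfl⟩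
    rw [h] at hAw
    obtain ⟨v, hv, hv'⟩ := hAw
    exact ⟨v, mem_fcc_of_mem_fccSlots (Finset.mem_coe.1 hv), hv'⟩
  exact Set.Subset.antisymm (key h) (key h.symm)

/-- **RE-PRESENTATION of the fcc plate by a frame carrying its dozen.** -/
theorem stacking_const_eq_of_dozen {σ : ℤ → ℤ} {ε : ℤ} (hσ : ∀ n : ℤ, σ n = ε) (L : E3 ≃ₗᵢ[ℝ] E3) (s : E3)
    (Gf : E3 ≃ₗᵢ[ℝ] E3) (hGf : (ε = 1 ∧ Gf = L) ∨ (ε = -1 ∧ Gf = basalMirror.trans L))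
    (Fr : E3 ≃ₗᵢ[ℝ] E3) (hdozen : (Fr : E3 → E3) '' ↑fccSlots = (Gf : E3 → E3) '' ↑fccSlots) :
    stacking L s σ = stacking Fr s constHagg := by
  have hσ' : σ = fun _ => ε := funext hσ
  have hΛ : Fr '' fccRef = Gf '' fccRef := image_fccRef_eq_of_image_fccSlots_eq hdozen
  have key : stacking L s σ = (fun p => Gf p + s) '' fccStacking 1 (Real.sqrt (2 / 3)) := by
    rcases hGf with ⟨h1, h2⟩ | ⟨h1, h2⟩
    · rw [hσ', h1, h2, const_one_eq_constHagg]; rfl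
    · rw [hσ', h1, h2]; exact stacking_const_neg L s
  rw [key, stacking_constHagg]
  have e1 : (fun p => Gf p + s) '' fccStacking 1 (Real.sqrt (2 / 3)) = (fun y => y + s) '' (Gf '' fccRef) := by
    rw [Set.image_image]; rfl
  have e2 : (fun p => Fr p + s) '' fccStacking 1 (Real.sqrt (2 / 3)) = (fun y => y + s) '' (Fr '' fccRef) := by
    rw [Set.image_image]; rfl
  rw [e1, e2, hΛ]

open scoped Classical in
/-- **(I2) raw: B-SOURCES FROM BELOW on prescribed layers.** -/
theorem oneFcc_srcB_layers_ge (FrB : E3 ≃ₗᵢ[ℝ] E3) (s' : E3) (P' : Finset E3) (R₀ h ρ : ℝ) (hR₀ : 3 ≤ R₀) (hh : 0 ≤ h)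
    (hρ : 4 ≤ ρ)
    (hP' : ∀ p, p ∈ P' ↔ (p ∈ stacking FrB s' constHagg ∧ -(2 * R₀) ≤ p 2 ∧ p 2 ≤ -R₀ ∧ p 0 ^ 2 + p 1 ^ 2 ≤ ρ ^ 2))
    (K : Finset ℤ) :
    ∑ m ∈ K, (4 * (∑ r ∈ inPlaneRoots FrB 1, (FrB r) 2) / (Real.sqrt 3 * (1 - (FrB.symm (EuclideanSpace.single (2 : Fin 3) (1 : ℝ))) 2 ^ 2)) *
          Real.sqrt (max 0 ((ρ - 4) ^ 2 * (1 - (FrB.symm (EuclideanSpace.single (2 : Fin 3) (1 : ℝ))) 2 ^ 2) -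
            ((m : ℝ) * Real.sqrt (2 / 3) + (FrB.symm s') 2 -
              (-(R₀ + 1) - 1) * (FrB.symm (EuclideanSpace.single (2 : Fin 3) (1 : ℝ))) 2) ^ 2)) -
          ((inPlaneRoots FrB 1).card : ℝ)) ≤
      ((∑ r ∈ inPlaneRoots FrB 1,
        ((P'.filter fun p => -(R₀ + 1) - 1 - 1 ≤ p 2 ∧ p 2 ≤ -(R₀ + 1) - 1 ∧ p 0 ^ 2 + p 1 ^ 2 ≤ (ρ - 1 - 1) ^ 2).filter
          fun p => -(R₀ + 1) - 1 < (p + FrB r) 2 ∧ (p + FrB r) 2 < h + (R₀ + 1) + 1).card : ℕ) : ℝ) := by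
  set RT := inPlaneRoots FrB 1 with hRTdef
  set ν₂ : ℝ := (FrB.symm (EuclideanSpace.single (2 : Fin 3) (1 : ℝ))) 2 with hν₂
  set S2 : ℝ := 1 - ν₂ ^ 2 with hS2
  set z₀ : ℝ := -(R₀ + 1) - 1 with hz₀
  set P := P'.filter (fun p => -(R₀ + 1) - 1 - 1 ≤ p 2 ∧ p 2 ≤ -(R₀ + 1) - 1 ∧ p 0 ^ 2 + p 1 ^ 2 ≤ (ρ - 1 - 1) ^ 2) with hP
  set G : ℤ → ℝ := fun m => Real.sqrt (max 0 ((ρ - 4) ^ 2 * S2 - ((m : ℝ) * Real.sqrt (2 / 3) + (FrB.symm s') 2 - z₀ * ν₂) ^ 2))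
    with hG
  have hRT : ∀ r ∈ RT, r ∈ fccSlots ∧ r 2 = 0 ∧ 0 < (FrB r) 2 := by
    intro r hr
    obtain ⟨hrS, hr2, hup⟩ := mem_filter.1 hr
    rw [one_mul] at hup
    exact ⟨hrS, hr2, hup⟩
  have hroot : ∀ r ∈ RT, ∑ m ∈ K, (4 * (FrB r) 2 * G m / (Real.sqrt 3 * S2) - 1) ≤
      (((P'.filter fun p => -(R₀ + 1) - 1 - 1 ≤ p 2 ∧ p 2 ≤ -(R₀ + 1) - 1 ∧ p 0 ^ 2 + p 1 ^ 2 ≤ (ρ - 1 - 1) ^ 2).filter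
          fun p => -(R₀ + 1) - 1 < (p + FrB r) 2 ∧ (p + FrB r) 2 < h + (R₀ + 1) + 1).card : ℝ) := by
    intro r hr
    obtain ⟨hrS, hr2, ha⟩ := hRT r hr
    have hPin : ∀ k ∈ K, ∀ i j : ℤ, z₀ - 1 < (FrB (barlowPos 1 (Real.sqrt (2 / 3)) constHagg k i j) + s') 2 →
        (FrB (barlowPos 1 (Real.sqrt (2 / 3)) constHagg k i j) + s') 2 ≤ z₀ →
        (FrB (barlowPos 1 (Real.sqrt (2 / 3)) constHagg k i j) + s') 0 ^ 2 +
            (FrB (barlowPos 1 (Real.sqrt (2 / 3)) constHagg k i j) + s') 1 ^ 2 ≤ (ρ - 4 + 1) ^ 2 →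
        FrB (barlowPos 1 (Real.sqrt (2 / 3)) constHagg k i j) + s' ∈ P := by
      intro k _ i j h1 h2 h3
      have hlat : (FrB (barlowPos 1 (Real.sqrt (2 / 3)) constHagg k i j) + s') 0 ^ 2 +
          (FrB (barlowPos 1 (Real.sqrt (2 / 3)) constHagg k i j) + s') 1 ^ 2 ≤ (ρ - 1 - 1) ^ 2 := h3.trans (by nlinarith)
      refine mem_filter.2 ⟨(hP' _).2 ⟨⟨_, barlowPos_mem _ _ _, rfl⟩, by linarith, by linarith, hlat.trans (by nlinarith)⟩,
        by linarith, h2, hlat⟩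
    have h := plate_tops_ge constHagg FrB s' hrS hr2 ha z₀ (ρ - 4) (by linarith) K P hPin
    refine h.trans ?_
    refine Nat.cast_le.2 (card_le_card fun p hp => ?_)
    obtain ⟨hpP, -, hp2, hcross⟩ := mem_filter.1 hp
    have hp2' : p 2 ≤ -(R₀ + 1) - 1 := (mem_filter.1 hpP).2.2.1
    have hFr2 : (FrB r) 2 ≤ 1 := by
      have h1 : ‖FrB r‖ = 1 := by rw [LinearIsometryEquiv.norm_map]; exact norm_eq_one_of_mem_fccSlots hrS
      have h2 := Literature.Algebra.EuclideanLattices.norm_sq_fin_three (FrB r)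
      rw [h1] at h2
      nlinarith [sq_nonneg ((FrB r) 0), sq_nonneg ((FrB r) 1), sq_nonneg ((FrB r) 2 - 1)]
    refine mem_filter.2 ⟨hpP, hcross, ?_⟩
    rw [PiLp.add_apply]; linarith
  have hsum : ∑ r ∈ RT, ∑ m ∈ K, (4 * (FrB r) 2 * G m / (Real.sqrt 3 * S2) - 1) =
      ∑ m ∈ K, (4 * (∑ r ∈ RT, (FrB r) 2) / (Real.sqrt 3 * S2) * G m - (RT.card : ℝ)) := by
    rw [Finset.sum_comm]
    refine Finset.sum_congr rfl fun m _ => ?_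
    rw [Finset.sum_sub_distrib, Finset.sum_const, nsmul_eq_mul, mul_one, Finset.mul_sum, Finset.sum_div, Finset.sum_mul]
    exact congrArg₂ _ (Finset.sum_congr rfl fun r _ => by ring) rfl
  have hmain := Finset.sum_le_sum hroot
  rw [hsum] at hmain
  push_cast
  exact le_trans (le_of_eq (Finset.sum_congr rfl fun m _ => by rw [hG])) hmain

/-- **Re-phasing an arithmetic progression**: `x₀ + k d + ψ' = e + (k − q) d` with `|ψ' − ψ| ≤ d`. -/
theorem ap_rephase (x₀ ψ e d : ℝ) (hd : 0 < d) :
    ∃ (ψ' : ℝ) (q : ℤ), |ψ' - ψ| ≤ d ∧ ∀ k : ℤ, x₀ + k * d + ψ' = e + ((k - q : ℤ) : ℝ) * d := by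
  set u : ℝ := (e - x₀ - ψ) / d with hu
  refine ⟨ψ + Int.fract u * d, ⌊u⌋, ?_, fun k => ?_⟩
  · rw [add_sub_cancel_left, abs_of_nonneg (mul_nonneg (Int.fract_nonneg u) hd.le)]
    have := Int.fract_lt_one u
    nlinarith
  · have hud : u * d = e - x₀ - ψ := by rw [hu]; field_simp
    rw [Int.fract]
    push_cast
    nlinarith [hud]

open scoped Classical in
/-- **(I2) B-SOURCES FROM BELOW, in the ledger's phase.**  See the module docstring. -/
theorem oneFcc_srcB_ge (FrB : E3 ≃ₗᵢ[ℝ] E3) (s' : E3) (P' : Finset E3) (R₀ h ρ : ℝ) (hR₀ : 3 ≤ R₀) (hh : 0 ≤ h)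
    (hρ : 4 ≤ ρ)
    (hP' : ∀ p, p ∈ P' ↔ (p ∈ stacking FrB s' constHagg ∧ -(2 * R₀) ≤ p 2 ∧ p 2 ≤ -R₀ ∧ p 0 ^ 2 + p 1 ^ 2 ≤ ρ ^ 2))
    (x₀ ψ : ℝ) (Kw : Finset ℤ) :
    ∃ ψ' : ℝ, |ψ' - ψ| ≤ Real.sqrt (2 / 3) ∧
      ∑ k ∈ Kw, (4 * (∑ r ∈ inPlaneRoots FrB 1, (FrB r) 2) /
            (Real.sqrt 3 * (1 - (FrB.symm (EuclideanSpace.single (2 : Fin 3) (1 : ℝ))) 2 ^ 2)) *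
          Real.sqrt (max 0 ((ρ - 4) ^ 2 * (1 - (FrB.symm (EuclideanSpace.single (2 : Fin 3) (1 : ℝ))) 2 ^ 2) -
            (x₀ + (k : ℝ) * Real.sqrt (2 / 3) + ψ') ^ 2)) - ((inPlaneRoots FrB 1).card : ℝ)) ≤
      ((∑ r ∈ inPlaneRoots FrB 1,
        ((P'.filter fun p => -(R₀ + 1) - 1 - 1 ≤ p 2 ∧ p 2 ≤ -(R₀ + 1) - 1 ∧ p 0 ^ 2 + p 1 ^ 2 ≤ (ρ - 1 - 1) ^ 2).filter
          fun p => -(R₀ + 1) - 1 < (p + FrB r) 2 ∧ (p + FrB r) 2 < h + (R₀ + 1) + 1).card : ℕ) : ℝ) := by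
  have hd : (0 : ℝ) < Real.sqrt (2 / 3) := Real.sqrt_pos.2 (by norm_num)
  obtain ⟨ψ', q, hψ', hk⟩ := ap_rephase x₀ ψ
    ((FrB.symm s') 2 - (-(R₀ + 1) - 1) * (FrB.symm (EuclideanSpace.single (2 : Fin 3) (1 : ℝ))) 2) (Real.sqrt (2 / 3)) hd
  refine ⟨ψ', hψ', ?_⟩
  have h := oneFcc_srcB_layers_ge FrB s' P' R₀ h ρ hR₀ hh hρ hP' (Kw.image fun k => k - q)
  refine le_trans (le_of_eq ?_) h
  rw [Finset.sum_image (fun a _ b _ hab => by simpa using hab)]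
  refine Finset.sum_congr rfl fun k _ => ?_
  have harg : x₀ + (k : ℝ) * Real.sqrt (2 / 3) + ψ' = ((k - q : ℤ) : ℝ) * Real.sqrt (2 / 3) + (FrB.symm s') 2 -
      (-(R₀ + 1) - 1) * (FrB.symm (EuclideanSpace.single (2 : Fin 3) (1 : ℝ))) 2 := by
    rw [hk k]; ring
  rw [harg]

end Summit.Ventures.Crystal3D.Theorems

end
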